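import Summits.KontsevichZagierPeriods.KontsevichZagierPeriods.Theorems.SoloInformedNLSummitForms
import Summits.KontsevichZagierPeriods.KontsevichZagierPeriods.Theorems.SoloInformedEquidimJunk
import Literature.NumberTheory.Transcendental.KZSemialgebraicComplex
import Literature.NumberTheory.Transcendental.SemialgebraicAlgebraicPoints
import HarnessLib
import HarnessLib.Audit

/-!
# SoloInformed — the stabilisation property STAB and the equidimensional kernel conjecture (COROLLARY NF.3, kernel)

Solo programme `solo-KontsevichZagierPeriods-informed`, session s246 (typed question STAB of
`paper/nl-elimination.md`, REMARK NF.5, made kernel).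

THEOREM NF (`soloInformed_relations_eq_sup`, unconditional) presents the Kontsevich–Zagier relations
as `relations = relations₁₂ ⊔ U`: the equidimensional moves (1a), (1b), (2) plus the flattening
differences `[r × [0,1]] − [r]`; equivalently (`soloInformed_mem_sup_iff_exists_flatPow`) a
homogeneous formal combination `x` of degree `d` is a relation iff `Fl^k x ∈ relations₁₂` for some
`k`, where `Fl = [[0,1]] * ·` is the flattening operator.  Two graded questions remain between this
normal form and the summit, and this file TYPES them and proves their exact relationship:

* `SoloInformedStabAt d` (**STAB_d**): `Fl` is injective modulo `relations₁₂` on degree `d` —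
  `π_d x = x → Fl x ∈ relations₁₂ → x ∈ relations₁₂` ("no `[0,1]`-torsion": the graded group
  `P₁₂ = FormalRep ⧸ relations₁₂` embeds in the KZ group `P = FormalRep ⧸ relations`, degreewise);
* `SoloInformedEquidimInjAt d` (**GKZ^dens_d**, the equidimensional kernel conjecture in degree `d`):
  `π_d x = x → eval x = 0 → x ∈ relations₁₂`.

Proved here (all unconditional):

* `soloInformed_stab_iff_forall_mem_relations_imp` — STAB `↔` (`P₁₂ → P` is injective on
  homogeneous elements): `∀ d x, π_d x = x → x ∈ relations → x ∈ relations₁₂`;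
* `soloInformed_stabAt_of_equidimInjAt` — GKZ^dens_d `→` STAB_d;
* **`soloInformed_equidimInj_iff`** — `(∀ d, GKZ^dens_d) ↔ KontsevichZagierPeriods ∧ STAB`
  (COROLLARY NF.3(d) of the paper: the equidimensional kernel conjecture is EXACTLY the period
  conjecture plus stabilisation; neither implication between the summit and STAB is claimed);
* **`soloInformed_equidimInjAt_zero`**, `soloInformed_stabAt_zero` — the degree-`0` cases hold:
  a degree-`0` formal combination with value `0` is an equidimensional relation (point
  representations `[pt, a]`, `a ∈ ℚ̄ ∩ ℝ`, and integrand additivity), so `× [0,1] : P₁₂,₀ → P₁₂,₁` is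
  injective.

No new analytic input: the file is bookkeeping over THEOREM NF and the torsion theorem
(`SoloInformedFlatTorsion`, `SoloInformedNLSummitForms`).

References: M. Kontsevich, D. Zagier, *Periods* (2001), §1.2; A. Huber, S. Müller-Stach, *Periods and
Nori Motives* (2017), §13.1; this work (THEOREM NF, COROLLARY NF.3, REMARK NF.5,
`paper/nl-elimination.md`).
-/

noncomputable section

open scoped BigOperators

namespace Summit.KontsevichZagierPeriods.KontsevichZagierPeriods.Theorems

open Set MeasureTheory
open Literature.ModelTheory.ExponentialFields
open Literature.NumberTheory.Transcendental Literature.NumberTheory.Transcendental.KZ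

variable {n d : ℕ}

/-! ### Evaluation on the equidimensional relations and under flattening -/

/-- `relations₁₂ ≤ ker eval` (soundness of the KZ calculus restricted to the equidimensional moves).
[Kontsevich–Zagier 2001, §1.2] -/
theorem soloInformed_eval_eq_zero_of_mem_equidimRelations {x : FormalRep}
    (hx : x ∈ soloInformedEquidimRelations) : eval x = 0 :=
  AddMonoidHom.mem_ker.mp
    (relations_le_ker_eval_holds (soloInformed_equidimRelations_le_relations hx))

/-- **Flattening preserves the value**: `eval (Fl x) = eval x`. [Kontsevich–Zagier 2001, §1.2, rule 3)] -/
theorem soloInformed_eval_flatMap (x : FormalRep) : eval (soloInformedFlatMap x) = eval x := by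
  have h := AddMonoidHom.mem_ker.mp (relations_le_ker_eval_holds
    (soloInformed_flatSpan_le_relations (soloInformed_flatMap_sub_self_mem_flatSpan x)))
  rwa [map_sub, sub_eq_zero] at h

/-- `eval (Fl^k x) = eval x`. [Kontsevich–Zagier 2001, §1.2, rule 3)] -/
theorem soloInformed_eval_flatPow (k : ℕ) (x : FormalRep) :
    eval (soloInformedFlatPow k x) = eval x := by
  induction k with
  | zero => rfl
  | succ k ih => rw [soloInformed_flatPow_succ_apply, soloInformed_eval_flatMap, ih]

/-! ### STAB: flattening is injective modulo the equidimensional relations -/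

/-- **STAB_d, the stabilisation property in degree `d`**: on formal combinations homogeneous of
degree `d`, `Fl x ∈ relations₁₂` already forces `x ∈ relations₁₂` (no `[0,1]`-torsion in the graded
group `FormalRep ⧸ relations₁₂` in degree `d`).  Open for `d ≥ 1`; `d = 0` is
`soloInformed_stabAt_zero`. [this work, REMARK NF.5 (typed question STAB)] -/
def SoloInformedStabAt (d : ℕ) : Prop :=
  ∀ x : FormalRep, soloInformedDimProj d x = x →
    soloInformedFlatMap x ∈ soloInformedEquidimRelations → x ∈ soloInformedEquidimRelations

/-- **STAB**: the stabilisation property in every degree. [this work, REMARK NF.5] -/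
def SoloInformedStab : Prop :=
  ∀ d : ℕ, SoloInformedStabAt d

/-- A homogeneous combination of degree `d` flattens to a homogeneous combination of degree `d + 1`.
[this work] -/
theorem soloInformed_dimProj_succ_flatMap_of_eq {x : FormalRep} (hx : soloInformedDimProj d x = x) :
    soloInformedDimProj (d + 1) (soloInformedFlatMap x) = soloInformedFlatMap x := by
  rw [soloInformed_dimProj_succ_flatMap, hx]

/-- STAB cancels every power of `Fl` on homogeneous combinations. [this work] -/
theorem soloInformed_flatPow_cancel_of_stab (h : SoloInformedStab) (k : ℕ) :
    ∀ {d : ℕ} {x : FormalRep}, soloInformedDimProj d x = x →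
      soloInformedFlatPow k x ∈ soloInformedEquidimRelations →
        x ∈ soloInformedEquidimRelations := by
  induction k with
  | zero => intro d x _ hk; exact hk
  | succ k ih =>
    intro d x hx hk
    rw [soloInformed_flatPow_succ_apply'] at hk
    exact h d x hx (ih (soloInformed_dimProj_succ_flatMap_of_eq hx) hk)

/-- **STAB `↔` the graded group `P₁₂` embeds in the Kontsevich–Zagier group `P`**: for homogeneous
`x`, `x ∈ relations → x ∈ relations₁₂` (by THEOREM NF, `relations = relations₁₂ ⊔ U`, and the
torsion description of `relations₁₂ ⊔ U`). [this work, THEOREM NF + REMARK NF.5] -/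
theorem soloInformed_stab_iff_forall_mem_relations_imp :
    SoloInformedStab ↔ ∀ (d : ℕ) (x : FormalRep), soloInformedDimProj d x = x →
      x ∈ relations → x ∈ soloInformedEquidimRelations := by
  constructor
  · intro h d x hx hrel
    rw [soloInformed_relations_eq_sup] at hrel
    obtain ⟨k, hk⟩ := (soloInformed_mem_sup_iff_exists_flatPow hx).mp hrel
    exact soloInformed_flatPow_cancel_of_stab h k hx hk
  · intro h d x hx hfl
    refine h d x hx ?_
    have h1 : soloInformedFlatMap x - x ∈ relations :=
      soloInformed_flatSpan_le_relations (soloInformed_flatMap_sub_self_mem_flatSpan x)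
    have h2 := relations.sub_mem (soloInformed_equidimRelations_le_relations hfl) h1
    rwa [sub_sub_cancel] at h2

/-! ### The equidimensional kernel conjecture, degreewise -/

/-- **GKZ^dens_d, the equidimensional kernel conjecture in degree `d`**: a homogeneous formal
combination of degree `d` with value `0` is an equidimensional relation (moves (1a), (1b), (2) in
dimension `d` only).  Open for `d ≥ 1`; `d = 0` is `soloInformed_equidimInjAt_zero`.
[this work, COROLLARY NF.3; Kontsevich–Zagier 2001, §1.2] -/
def SoloInformedEquidimInjAt (d : ℕ) : Prop :=
  ∀ x : FormalRep, soloInformedDimProj d x = x → eval x = 0 → x ∈ soloInformedEquidimRelations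

/-- **GKZ^dens**: the equidimensional kernel conjecture in every degree. [this work, COROLLARY NF.3] -/
def SoloInformedEquidimInj : Prop :=
  ∀ d : ℕ, SoloInformedEquidimInjAt d

/-- GKZ^dens_d `→` STAB_d (`Fl` preserves the value). [this work, COROLLARY NF.3] -/
theorem soloInformed_stabAt_of_equidimInjAt (h : SoloInformedEquidimInjAt d) :
    SoloInformedStabAt d := fun x hx hfl =>
  h x hx (by
    rw [← soloInformed_eval_flatMap]
    exact soloInformed_eval_eq_zero_of_mem_equidimRelations hfl)

/-- GKZ^dens_d on pairs: two representations of dimension `d` with the same value differ by an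
equidimensional relation. [this work, COROLLARY NF.3] -/
theorem soloInformed_of_sub_of_mem_of_equidimInjAt (h : SoloInformedEquidimInjAt d)
    (r r' : IntegralRep d) (hv : r.value = r'.value) :
    of r - of r' ∈ soloInformedEquidimRelations :=
  h _ (by rw [map_sub, soloInformed_dimProj_of_self, soloInformed_dimProj_of_self])
    (by rw [map_sub, eval_of, eval_of, hv, sub_self])

/-- **COROLLARY NF.3(d): GKZ^dens `↔` the period conjecture `∧` STAB.**  (`→`: a null `c` has null
homogeneous representatives `Φ_N c` in all large degrees, which GKZ^dens puts in `relations₁₂`, and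
this is the summit by `soloInformed_summit_iff_totalFlat`; `←`: the summit puts a null homogeneous `x`
in `relations₁₂ ⊔ U`, i.e. `Fl^k x ∈ relations₁₂` for some `k`, and STAB cancels the `Fl^k`.)
[this work, COROLLARY NF.3 + THEOREM NF] -/
theorem soloInformed_equidimInj_iff :
    SoloInformedEquidimInj ↔ KontsevichZagierPeriods ∧ SoloInformedStab := by
  constructor
  · intro h
    refine ⟨?_, fun d => soloInformed_stabAt_of_equidimInjAt (h d)⟩
    rw [soloInformed_summit_iff_totalFlat]
    intro c hc
    obtain ⟨M, hM⟩ := soloInformed_exists_totalFlat_sub_self_mem_flatSpan c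
    refine ⟨M, fun N hN => h N _ (soloInformed_dimProj_totalFlat N c) ?_⟩
    have h1 := AddMonoidHom.mem_ker.mp (relations_le_ker_eval_holds
      (soloInformed_flatSpan_le_relations (hM N hN)))
    rwa [map_sub, hc, sub_zero] at h1
  · rintro ⟨hK, hS⟩ d x hx hx0
    have hfl : x ∈ soloInformedEquidimRelations ⊔ soloInformedFlatSpan :=
      soloInformed_summit_iff_flatKZConjecture.mp hK x hx0
    obtain ⟨k, hk⟩ := (soloInformed_mem_sup_iff_exists_flatPow hx).mp hfl
    exact soloInformed_flatPow_cancel_of_stab hS k hx hk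

/-- Under STAB the summit is the equidimensional kernel conjecture. [this work, COROLLARY NF.3] -/
theorem soloInformed_summit_iff_equidimInj_of_stab (hS : SoloInformedStab) :
    KontsevichZagierPeriods ↔ SoloInformedEquidimInj := by
  rw [soloInformed_equidimInj_iff]
  exact ⟨fun h => ⟨h, hS⟩, fun h => h.1⟩

/-! ### Degree zero -/

/-- **The point representation `[pt, a]`** (`a` real algebraic): domain `ℝ⁰ = {pt}`, integrand `a`.
[Kontsevich–Zagier 2001, §1.1] -/
def soloInformedScalarRep (a : ℝ) (ha : IsAlgebraic ℚ a) : IntegralRep 0 where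
  domain := univ
  integrand := fun _ => a
  isSemialgebraic_domain := isSemialgebraic_univ
  isSemialgebraicFunOn_integrand := isSemialgebraicFunOn_const_of_isAlgebraic isSemialgebraic_univ ha
  integrableOn := integrableOn_const (hs := by rw [volume_pi, Measure.pi_univ]; simp)

/-- Domain of `[pt, a]`. [Kontsevich–Zagier 2001, §1.1] -/
@[simp] theorem soloInformed_scalarRep_domain (a : ℝ) (ha : IsAlgebraic ℚ a) :
    (soloInformedScalarRep a ha).domain = univ := rfl

/-- Integrand of `[pt, a]`. [Kontsevich–Zagier 2001, §1.1] -/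
@[simp] theorem soloInformed_scalarRep_integrand (a : ℝ) (ha : IsAlgebraic ℚ a) :
    (soloInformedScalarRep a ha).integrand = fun _ => a := rfl

/-- `value [pt, a] = a` (`ℝ⁰` is one point of volume `1`). [Kontsevich–Zagier 2001, §1.1] -/
@[simp] theorem soloInformed_value_scalarRep (a : ℝ) (ha : IsAlgebraic ℚ a) :
    (soloInformedScalarRep a ha).value = a := by
  have hv : volume (univ : Set (Fin 0 → ℝ)) = 1 := by rw [volume_pi, Measure.pi_univ]; simp
  simp [IntegralRep.value, Measure.restrict_univ, measureReal_def, hv]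

/-- `[pt, a + b] − [pt, a] − [pt, b] ∈ relations₁₂` (integrand additivity).
[Kontsevich–Zagier 2001, §1.2, rule 1)] -/
theorem soloInformed_scalarRep_add_sub_mem {a b : ℝ} (ha : IsAlgebraic ℚ a) (hb : IsAlgebraic ℚ b) :
    of (soloInformedScalarRep (a + b) (ha.add hb)) - of (soloInformedScalarRep a ha) -
      of (soloInformedScalarRep b hb) ∈ soloInformedEquidimRelations :=
  soloInformed_integrandAddRel_subset_equidimRelations
    ⟨0, soloInformedScalarRep (a + b) (ha.add hb), soloInformedScalarRep a ha,
      soloInformedScalarRep b hb, rfl, rfl, fun _ _ => rfl, rfl⟩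

/-- `−[pt, a] − [pt, −a] ∈ relations₁₂` (free cancellation). [Kontsevich–Zagier 2001, §1.2, rule 1)] -/
theorem soloInformed_scalarRep_neg_sub_mem {a : ℝ} (ha : IsAlgebraic ℚ a) :
    -of (soloInformedScalarRep a ha) - of (soloInformedScalarRep (-a) ha.neg) ∈
      soloInformedEquidimRelations := by
  have h1 : of (soloInformedScalarRep a ha) + of (soloInformedScalarRep a ha).neg ∈
      soloInformedEquidimRelations := soloInformed_of_add_of_neg_mem_equidimRelations _
  have h2 : of (soloInformedScalarRep a ha).neg - of (soloInformedScalarRep (-a) ha.neg) ∈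
      soloInformedEquidimRelations :=
    soloInformed_of_sub_of_mem_equidimRelations_of_eqOn rfl fun _ _ => rfl
  have h := soloInformedEquidimRelations.add_mem (soloInformedEquidimRelations.neg_mem h1) h2
  convert h using 1
  abel

/-- **Degree-`0` normal form**: the degree-`0` component of any formal combination is a single point
representation `[pt, a]` (`a` real algebraic) modulo `relations₁₂`.  (A representation of dimension
`0` has domain `∅` — junk — or `{pt}`, where its integrand takes an algebraic value; sums and
negatives of point representations are point representations by integrand additivity.)
[Kontsevich–Zagier 2001, §1.1–1.2] -/
theorem soloInformed_exists_scalarRep_of_dimProj_zero (x : FormalRep) :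
    ∃ (a : ℝ) (ha : IsAlgebraic ℚ a),
      soloInformedDimProj 0 x - of (soloInformedScalarRep a ha) ∈ soloInformedEquidimRelations := by
  induction x using FreeAbelianGroup.induction_on with
  | zero =>
    refine ⟨0, isAlgebraic_zero, ?_⟩
    rw [map_zero, zero_sub]
    exact soloInformedEquidimRelations.neg_mem
      (soloInformed_of_mem_equidimRelations_of_eqOn_zero _ fun _ _ => rfl)
  | of x =>
    obtain ⟨n, r⟩ := x
    change ∃ (a : ℝ) (ha : IsAlgebraic ℚ a),
      soloInformedDimProj 0 (of r) - of (soloInformedScalarRep a ha) ∈ soloInformedEquidimRelations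
    by_cases hn : n = 0
    · subst hn
      rw [soloInformed_dimProj_of_self]
      by_cases hmem : (Fin.elim0 : Fin 0 → ℝ) ∈ r.domain
      · have hdom : r.domain = univ :=
          eq_univ_of_forall fun x => (Subsingleton.elim Fin.elim0 x) ▸ hmem
        have halg : IsAlgebraic ℚ (r.integrand Fin.elim0) :=
          r.isSemialgebraicFunOn_integrand.isAlgebraic_apply hmem fun i => i.elim0
        refine ⟨_, halg, soloInformed_of_sub_of_mem_equidimRelations_of_eqOn
          (by rw [soloInformed_scalarRep_domain, hdom]) fun x _ => ?_⟩
        rw [soloInformed_scalarRep_integrand, Subsingleton.elim x Fin.elim0]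
      · have hdom : r.domain = ∅ :=
          Set.eq_empty_of_subset_empty fun x hx => hmem ((Subsingleton.elim x Fin.elim0) ▸ hx)
        refine ⟨0, isAlgebraic_zero, soloInformedEquidimRelations.sub_mem ?_ ?_⟩
        · exact soloInformed_of_mem_equidimRelations_of_volume_eq_zero r
            (by rw [hdom, measure_empty])
        · exact soloInformed_of_mem_equidimRelations_of_eqOn_zero _ fun _ _ => rfl
    · refine ⟨0, isAlgebraic_zero, ?_⟩
      rw [soloInformed_dimProj_of_ne hn, zero_sub]
      exact soloInformedEquidimRelations.neg_mem
        (soloInformed_of_mem_equidimRelations_of_eqOn_zero _ fun _ _ => rfl)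
  | neg x ih =>
    obtain ⟨a, ha, h⟩ := ih
    refine ⟨-a, ha.neg, ?_⟩
    rw [map_neg]
    have h' := soloInformedEquidimRelations.add_mem (soloInformedEquidimRelations.neg_mem h)
      (soloInformed_scalarRep_neg_sub_mem ha)
    convert h' using 1
    abel
  | add x y hx hy =>
    obtain ⟨a, ha, h1⟩ := hx
    obtain ⟨b, hb, h2⟩ := hy
    refine ⟨a + b, ha.add hb, ?_⟩
    rw [map_add]
    have h' := soloInformedEquidimRelations.sub_mem (soloInformedEquidimRelations.add_mem h1 h2)
      (soloInformed_scalarRep_add_sub_mem ha hb)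
    convert h' using 1
    abel

/-- **GKZ^dens_0 holds**: a degree-`0` formal combination with value `0` is an equidimensional
relation. [this work, COROLLARY NF.3 (degree 0); Kontsevich–Zagier 2001, §1.2] -/
theorem soloInformed_equidimInjAt_zero : SoloInformedEquidimInjAt 0 := by
  intro x hx hx0
  obtain ⟨a, ha, h⟩ := soloInformed_exists_scalarRep_of_dimProj_zero x
  rw [hx] at h
  have ha0 : a = 0 := by
    have h1 := soloInformed_eval_eq_zero_of_mem_equidimRelations h
    rwa [map_sub, hx0, eval_of, soloInformed_value_scalarRep, zero_sub, neg_eq_zero] at h1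
  have h2 : of (soloInformedScalarRep a ha) ∈ soloInformedEquidimRelations :=
    soloInformed_of_mem_equidimRelations_of_eqOn_zero _ fun _ _ => ha0
  have h3 := soloInformedEquidimRelations.add_mem h h2
  rwa [sub_add_cancel] at h3

/-- **STAB_0 holds**: `× [0,1] : P₁₂,₀ → P₁₂,₁` is injective. [this work, REMARK NF.5 (degree 0)] -/
theorem soloInformed_stabAt_zero : SoloInformedStabAt 0 :=
  soloInformed_stabAt_of_equidimInjAt soloInformed_equidimInjAt_zero

/-- Degree `0` of the period conjecture inside dimension `0`: two representations of dimension `0`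
with the same value differ by an equidimensional relation. [Kontsevich–Zagier 2001, §1.2] -/
theorem soloInformed_of_sub_of_mem_equidimRelations_dim_zero (r r' : IntegralRep 0)
    (hv : r.value = r'.value) : of r - of r' ∈ soloInformedEquidimRelations :=
  soloInformed_of_sub_of_mem_of_equidimInjAt soloInformed_equidimInjAt_zero r r' hv

end Summit.KontsevichZagierPeriods.KontsevichZagierPeriods.Theorems

end
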